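import Literature.NumberTheory.PAdicHodge.TateNormalizedTrace
import Literature.NumberTheory.PAdicHodge.AxSenTateBase
import HarnessLib

/-!
# Tate's theorem over the base: `ℂ_F(χ^j)^{Gal(F̄/ℚ_p)} = 0` for `j ≠ 0`

Continuation of `TateNormalizedTrace` and `AxSenTateBase`. Notation as there: `F` a non-archimedean
local field of characteristic `0` and residue characteristic `p`, `K₀ = PadicBase F p hp ≅ ℚ_p`,
`F̄ = NormedAlgClosure F`, `ℂ_F = CompletedAlgClosure F`, `G₀ = BaseGaloisGroup hp = Gal(F̄/K₀)`,
`χ : G₀ → ℤ_pˣ` the cyclotomic character (`baseCyclotomicCharacter`), `K M = K₀(ζ_{p^M})`,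
`K_∞ = ⋃ K M` (`TateTrace.Kinf`), `γ = gen n`.

We assemble Tate's proof (Tate 1967, §3.3, Theorem 1 ⇒ Theorem 2 for `H⁰`) of

  `{x ∈ ℂ_F | g • x = ι(χ(g))^j x for all g ∈ G₀} = 0`   (`j ∈ ℤ ∖ {0}`)

(`CompletedAlgClosure.eq_zero_of_forall_base_smul_eq`), where `ι : ℤ_p → K₀ → F → ℂ_F`:
1. such an `x` is fixed by `Gal(F̄/K_∞) = ker χ`, hence lies in `X = \widehat{K_∞}` (closure of
   `K_∞` in `ℂ_F`) by Ax–Sen–Tate over `K_∞` (`AxSenTateBase`);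
2. Tate's normalised trace `R_n : K_∞ → K n` (`TateNormalizedTrace`, for the generator `γ` of
   `Gal(K_∞/K n)`) is Lipschitz, hence extends to `X` (`TateTrace.Rhat`), keeping its properties:
   `γ`-invariance of its values, `R_n(γ x) = R_n x`, `K₀`-linearity and Tate's estimate
   `‖x - R_n x‖ ≤ ‖p‖⁻² ‖γ x - x‖`;
3. EIGENVECTOR LEMMA (`TateTrace.eq_zero_of_gen_smul_eq`): if `x ∈ X` and `γ • x = c x` with
   `c ∈ K₀`, `c ≠ 1`, `‖p‖⁻² ‖c - 1‖ < 1`, then `x = 0` (`R_n x = R_n(γ x) = c R_n x` forces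
   `R_n x = 0`, and then `‖x‖ ≤ ‖p‖⁻² ‖(c-1) x‖ < ‖x‖`);
4. for `γ = gen 3`, `c = ι(χ(γ))^j` satisfies `‖c - 1‖ ≤ ‖p‖³` (`χ(γ) ≡ 1 mod p³`) and `c ≠ 1`
   (the order of `χ(γ) = 1 + p³ a`, `p ∤ a`, modulo `p^M` is `p^{M-3}`, unbounded).

The descent from `G₀` to `Γ_F` (Tate's theorem for the local field `F` itself) is
`TateTwistInvariants`.

## References

* J. Tate, *p-divisible groups* (1967), §3.3, Theorems 1 and 2 (`H⁰(K, C(χ)) = 0` for `χ` of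
  infinite order), with §3.1 Prop. 6 and §3.2 Prop. 7. [Tate1967]
* J.-M. Fontaine, Y. Ouyang, *Theory of p-adic Galois representations*, §3.1–§3.2 (Tate's
  normalised traces, `C(χ)^{G_K} = 0`). [FontaineOuyang2022]
* J. Ax, *Zeros of polynomials over local fields*, J. Algebra 15 (1970) (`C^H = \widehat{L}`). [Ax1970]
-/

noncomputable section

open ValuativeRel Field UniformSpace Filter Topology Finset

open scoped IntermediateField

namespace Literature.NumberTheory.PAdicHodge

open Literature.NumberTheory.GaloisRepresentations
open Literature.NumberTheory.GaloisRepresentations.IsNonarchimedeanLocalField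
open CyclotomicTower

variable {F : Type} [Field F] [ValuativeRel F] [TopologicalSpace F] [IsNonarchimedeanLocalField F]
  [CharZero F] {p : ℕ} [Fact p.Prime] (hp : valuation F p < 1)

namespace TateTrace

/-! ### The field `K_∞ = K₀(μ_{p^∞})` -/

/-- **`K_∞ = ⋃_M K₀(ζ_{p^M})`**, the cyclotomic `ℤ_p`-extension tower of the base field (as an
intermediate field of `F̄/K₀`). [cite: Tate1967, §3.1] -/
def Kinf : IntermediateField (PadicBase F p hp) (NormedAlgClosure F) := ⨆ M : ℕ, K hp M

/-- `x ∈ K_∞ ↔ x ∈ K M` for some `M` (directed union). [folklore] -/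
theorem mem_Kinf_iff {x : NormedAlgClosure F} : x ∈ Kinf hp ↔ ∃ M, x ∈ K hp M := by
  rw [Kinf, ← SetLike.mem_coe, IntermediateField.coe_iSup_of_directed (K_mono hp).directed_le,
    Set.mem_iUnion]
  rfl

/-- `K M ≤ K_∞`. [folklore] -/
theorem K_le_Kinf (M : ℕ) : K hp M ≤ Kinf hp := by
  intro x hx; exact (mem_Kinf_iff hp).mpr ⟨M, hx⟩

/-- An element of `K_∞` lies in `K M` for some `M > n`. [folklore] -/
theorem exists_mem_K_of_mem_Kinf {x : NormedAlgClosure F} (hx : x ∈ Kinf hp) (n : ℕ) :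
    ∃ M, n + 1 ≤ M ∧ x ∈ K hp M := by
  obtain ⟨M, hM⟩ := (mem_Kinf_iff hp).mp hx
  exact ⟨max M (n + 1), le_max_right _ _, K_mono hp (le_max_left _ _) hM⟩

/-- `g ∈ G₀` fixes `K_∞` pointwise iff it fixes every `ζ_{p^M}`. [folklore] -/
theorem forall_mem_Kinf_smul_eq_iff (g : BaseGaloisGroup hp) :
    (∀ y ∈ Kinf hp, g • y = y) ↔ ∀ M, g • zeta F p M = zeta F p M := by
  constructor
  · intro h M; exact h _ (K_le_Kinf hp M (zeta_mem_K hp M))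
  · intro h y hy
    obtain ⟨M, hM⟩ := (mem_Kinf_iff hp).mp hy
    have h1 : g • zeta F p M = (1 : BaseGaloisGroup hp) • zeta F p M := by rw [h M, one_smul]
    have := smul_eq_smul_of_smul_zeta_eq hp h1 hM
    rwa [one_smul] at this

/-! ### `K_∞ ⊆ ℂ_F` and its closure `X = \\widehat{K_∞}` -/

/-- The image `S` of `K_∞` in `ℂ_F`. [folklore] -/
def S : Set (CompletedAlgClosure F) :=
  (fun y : NormedAlgClosure F => (y : CompletedAlgClosure F)) '' (Kinf hp : Set (NormedAlgClosure F))

/-- **`X = \\widehat{K_∞}`**: the closure of `K_∞` in `ℂ_F`. [cite: Tate1967, §3.1] -/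
def X : Set (CompletedAlgClosure F) := closure (S hp)

/-- Membership in `S`. [folklore] -/
theorem mem_S_iff {s : CompletedAlgClosure F} :
    s ∈ S hp ↔ ∃ y : NormedAlgClosure F, y ∈ Kinf hp ∧ (y : CompletedAlgClosure F) = s := by
  simp only [S, Set.mem_image, SetLike.mem_coe]

/-- Elements of `K_∞` give elements of `S`. [folklore] -/
theorem coe_mem_S {y : NormedAlgClosure F} (hy : y ∈ Kinf hp) : (y : CompletedAlgClosure F) ∈ S hp :=
  (mem_S_iff hp).mpr ⟨y, hy, rfl⟩

/-- `S ⊆ X`. [folklore] -/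
theorem S_subset_X : S hp ⊆ X hp := subset_closure

/-- **Ax–Sen–Tate for `K_∞`**: the elements of `ℂ_F` fixed by every `g ∈ G₀` fixing all `ζ_{p^M}`
are exactly `X = \\widehat{K_∞}`. [cite: Ax1970, main Theorem] [cite: Tate1967, §3.3 Theorem 1] -/
theorem fixedPoints_eq_X :
    {x : CompletedAlgClosure F |
      ∀ g : BaseGaloisGroup hp, (∀ M, g • zeta F p M = zeta F p M) → g • x = x} = X hp := by
  have h := CompletedAlgClosure.fixedPoints_base_eq_closure hp (Kinf hp)
  rw [X, S, ← h]
  ext x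
  simp only [Set.mem_setOf_eq]
  constructor
  · intro hx g hg; exact hx g ((forall_mem_Kinf_smul_eq_iff hp g).mp hg)
  · intro hx g hg; exact hx g ((forall_mem_Kinf_smul_eq_iff hp g).mpr hg)

/-- The scalar `ι c ∈ ℂ_F` of `c ∈ K₀` (`K₀ → F → ℂ_F`). [folklore] -/
def ι (c : PadicBase F p hp) : CompletedAlgClosure F :=
  algebraMap F (CompletedAlgClosure F) (algebraMap (PadicBase F p hp) F c)

/-- Unfolding of `ι`. [folklore] -/
theorem ι_def (c : PadicBase F p hp) :
    ι hp c = algebraMap F (CompletedAlgClosure F) (algebraMap (PadicBase F p hp) F c) := rfl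

/-- `ι` is a ring homomorphism. [folklore] -/
def ιHom : PadicBase F p hp →+* CompletedAlgClosure F :=
  (algebraMap F (CompletedAlgClosure F)).comp (algebraMap (PadicBase F p hp) F)

/-- `ιHom` is `ι`. [folklore] -/
theorem ιHom_apply (c : PadicBase F p hp) : ιHom hp c = ι hp c := rfl

/-- `‖ι c‖ = ‖c‖`. [folklore] -/
theorem norm_ι (c : PadicBase F p hp) : ‖ι hp c‖ = ‖c‖ := by
  rw [ι_def, CompletedAlgClosure.norm_algebraMap, PadicBase.norm_algebraMap]

/-- `↑(c • y) = ι c * ↑y`. [folklore] -/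
theorem coe_base_smul (c : PadicBase F p hp) (y : NormedAlgClosure F) :
    ((c • y : NormedAlgClosure F) : CompletedAlgClosure F) = ι hp c * (y : CompletedAlgClosure F) := by
  rw [Algebra.smul_def, Completion.coe_mul, PadicBase.algebraMap_closure_eq, ι_def,
    CompletedAlgClosure.algebraMap_eq_coe]

/-- `G₀` fixes `ι c`. [folklore] -/
theorem base_smul_ι (g : BaseGaloisGroup hp) (c : PadicBase F p hp) : g • ι hp c = ι hp c :=
  CompletedAlgClosure.base_smul_algebraMap hp g c

/-- `S` is closed under subtraction. [folklore] -/
theorem sub_mem_S {s t : CompletedAlgClosure F} (hs : s ∈ S hp) (ht : t ∈ S hp) : s - t ∈ S hp := by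
  obtain ⟨y, hy, rfl⟩ := (mem_S_iff hp).mp hs
  obtain ⟨z, hz, rfl⟩ := (mem_S_iff hp).mp ht
  exact (mem_S_iff hp).mpr ⟨y - z, sub_mem hy hz, Completion.coe_sub y z⟩

/-- `S` is `G₀`-stable. [folklore] -/
theorem smul_mem_S (g : BaseGaloisGroup hp) {s : CompletedAlgClosure F} (hs : s ∈ S hp) :
    g • s ∈ S hp := by
  obtain ⟨y, hy, rfl⟩ := (mem_S_iff hp).mp hs
  obtain ⟨M, hM⟩ := (mem_Kinf_iff hp).mp hy
  rw [CompletedAlgClosure.base_smul_coe]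
  exact coe_mem_S hp (K_le_Kinf hp M (smul_mem_K hp g hM))

/-- `S` is stable under multiplication by `ι c`. [folklore] -/
theorem ι_mul_mem_S (c : PadicBase F p hp) {s : CompletedAlgClosure F} (hs : s ∈ S hp) :
    ι hp c * s ∈ S hp := by
  obtain ⟨y, hy, rfl⟩ := (mem_S_iff hp).mp hs
  rw [← coe_base_smul]
  exact coe_mem_S hp (IntermediateField.smul_mem _ hy)

/-- `X` is `G₀`-stable. [folklore] -/
theorem smul_mem_X (g : BaseGaloisGroup hp) {x : CompletedAlgClosure F} (hx : x ∈ X hp) :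
    g • x ∈ X hp := by
  have hcont : Continuous fun z : CompletedAlgClosure F => g • z :=
    CompletedAlgClosure.continuous_base_smul hp g
  have h1 : (fun z : CompletedAlgClosure F => g • z) '' S hp ⊆ S hp := by
    rintro _ ⟨s, hs, rfl⟩; exact smul_mem_S hp g hs
  exact closure_mono h1 (image_closure_subset_closure_image hcont ⟨x, hx, rfl⟩)

/-- `X` is stable under multiplication by `ι c`. [folklore] -/
theorem ι_mul_mem_X (c : PadicBase F p hp) {x : CompletedAlgClosure F} (hx : x ∈ X hp) :
    ι hp c * x ∈ X hp := by
  have hcont : Continuous fun z : CompletedAlgClosure F => ι hp c * z := continuous_const_mul _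
  have h1 : (fun z : CompletedAlgClosure F => ι hp c * z) '' S hp ⊆ S hp := by
    rintro _ ⟨s, hs, rfl⟩; exact ι_mul_mem_S hp c hs
  exact closure_mono h1 (image_closure_subset_closure_image hcont ⟨x, hx, rfl⟩)

/-! ### `R_n` on `S` -/

section Rfun

variable (n : ℕ)

/-- The preimage in `K_∞` of `s ∈ S`. [folklore] -/
def pre (s : S hp) : NormedAlgClosure F := ((mem_S_iff hp).mp s.2).choose

/-- `pre s ∈ K_∞`. [folklore] -/
theorem pre_mem (s : S hp) : pre hp s ∈ Kinf hp := ((mem_S_iff hp).mp s.2).choose_spec.1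

/-- `↑(pre s) = s`. [folklore] -/
theorem coe_pre (s : S hp) : (pre hp s : CompletedAlgClosure F) = s := ((mem_S_iff hp).mp s.2).choose_spec.2

/-- A level `M > n` with `pre s ∈ K M`. [folklore] -/
def lvl (s : S hp) : ℕ := (exists_mem_K_of_mem_Kinf hp (pre_mem hp s) n).choose

/-- `lvl s > n` and `pre s ∈ K (lvl s)`. [folklore] -/
theorem lvl_spec (s : S hp) : n + 1 ≤ lvl hp n s ∧ pre hp s ∈ K hp (lvl hp n s) :=
  (exists_mem_K_of_mem_Kinf hp (pre_mem hp s) n).choose_spec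

/-- **`R_n` on `S = K_∞ ⊆ ℂ_F`**: `R_n s = ↑(traceToLevel n M y)` for `s = ↑y`, `y ∈ K M`, `M > n`
(independent of the choices, `Rfun_eq`). [cite: Tate1967, §3.1] -/
def Rfun (s : S hp) : CompletedAlgClosure F :=
  (traceToLevel hp n (lvl hp n s) (pre hp s) : CompletedAlgClosure F)

variable {n}

/-- `R_n s` may be computed with ANY representative and level. [folklore] -/
theorem Rfun_eq (hn : 1 ≤ n) {s : S hp} {y : NormedAlgClosure F} {M : ℕ}
    (hy : (y : CompletedAlgClosure F) = s) (hM : n + 1 ≤ M) (hyM : y ∈ K hp M) :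
    Rfun hp n s = (traceToLevel hp n M y : CompletedAlgClosure F) := by
  have hpre : pre hp s = y := Completion.coe_injective _ ((coe_pre hp s).trans hy.symm)
  obtain ⟨hl, hmem⟩ := lvl_spec hp n s
  rw [Rfun, hpre]
  rw [hpre] at hmem
  congr 1
  rcases le_total (lvl hp n s) M with h | h
  · rw [traceToLevel_eq_of_mem_K hp hn hl h hmem]
  · rw [traceToLevel_eq_of_mem_K hp hn hM h hyM]

/-- A common level for two elements of `S`. [folklore] -/
theorem exists_common_level (n : ℕ) (s t : S hp) :
    ∃ (y z : NormedAlgClosure F) (M : ℕ), (y : CompletedAlgClosure F) = s ∧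
      (z : CompletedAlgClosure F) = t ∧ n + 1 ≤ M ∧ y ∈ K hp M ∧ z ∈ K hp M := by
  obtain ⟨hl, hmem⟩ := lvl_spec hp n s
  obtain ⟨hl', hmem'⟩ := lvl_spec hp n t
  refine ⟨pre hp s, pre hp t, max (lvl hp n s) (lvl hp n t), coe_pre hp s, coe_pre hp t,
    le_trans hl (le_max_left _ _), K_mono hp (le_max_left _ _) hmem, K_mono hp (le_max_right _ _) hmem'⟩

/-- **Uniform bound**: `‖R_n s‖ ≤ ‖p‖⁻¹ ‖s‖` on `S`. [cite: Tate1967, §3.1 Prop. 6] -/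
theorem norm_Rfun_le (hn : 2 ≤ n) (s : S hp) :
    ‖Rfun hp n s‖ ≤ ‖(p : PadicBase F p hp)‖⁻¹ * ‖(s : CompletedAlgClosure F)‖ := by
  obtain ⟨hl, hmem⟩ := lvl_spec hp n s
  rw [Rfun, Completion.norm_coe, ← coe_pre hp s, Completion.norm_coe]
  exact norm_traceToLevel_le hp hn hl hmem

/-- **`R_n` is Lipschitz on `S`**: `‖R_n s - R_n t‖ ≤ ‖p‖⁻¹ ‖s - t‖`. [cite: Tate1967, §3.1 Prop. 6] -/
theorem norm_Rfun_sub_Rfun_le (hn : 2 ≤ n) (s t : S hp) :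
    ‖Rfun hp n s - Rfun hp n t‖ ≤
      ‖(p : PadicBase F p hp)‖⁻¹ * ‖(s : CompletedAlgClosure F) - (t : CompletedAlgClosure F)‖ := by
  obtain ⟨y, z, M, hy, hz, hM, hyM, hzM⟩ := exists_common_level hp n s t
  rw [Rfun_eq hp (by omega) hy hM hyM, Rfun_eq hp (by omega) hz hM hzM, ← Completion.coe_sub,
    ← traceToLevel_sub, Completion.norm_coe, ← hy, ← hz, ← Completion.coe_sub, Completion.norm_coe]
  exact norm_traceToLevel_le hp hn hM (sub_mem hyM hzM)

/-- `R_n` is uniformly continuous on `S`. [folklore] -/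
theorem uniformContinuous_Rfun (hn : 2 ≤ n) : UniformContinuous (Rfun hp n) := by
  refine Metric.uniformContinuous_iff.mpr fun ε hε => ?_
  set C : ℝ := ‖(p : PadicBase F p hp)‖⁻¹ with hC
  have hC0 : 0 < C := inv_pos.mpr (PadicBase.norm_p_pos hp)
  refine ⟨ε / C, div_pos hε hC0, fun {s t} hst => ?_⟩
  rw [Subtype.dist_eq, dist_eq_norm] at hst
  rw [dist_eq_norm]
  calc ‖Rfun hp n s - Rfun hp n t‖ ≤ C * ‖(s : CompletedAlgClosure F) - t‖ := norm_Rfun_sub_Rfun_le hp hn s t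
    _ < C * (ε / C) := mul_lt_mul_of_pos_left hst hC0
    _ = ε := mul_div_cancel₀ ε hC0.ne'

/-- **`R_n s` is fixed by `γ`.** [cite: Tate1967, §3.1] -/
theorem gen_smul_Rfun (hn : 1 ≤ n) (s : S hp) : gen hp n • Rfun hp n s = Rfun hp n s := by
  obtain ⟨hl, hmem⟩ := lvl_spec hp n s
  rw [Rfun, CompletedAlgClosure.base_smul_coe, gen_smul_traceToLevel hp hn hl hmem]

/-- **`R_n (γ s) = R_n s`.** [cite: Tate1967, §3.1] -/
theorem Rfun_gen_smul (hn : 1 ≤ n) (s : S hp) (h : gen hp n • (s : CompletedAlgClosure F) ∈ S hp) :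
    Rfun hp n ⟨gen hp n • (s : CompletedAlgClosure F), h⟩ = Rfun hp n s := by
  obtain ⟨hl, hmem⟩ := lvl_spec hp n s
  have hy : ((gen hp n • pre hp s : NormedAlgClosure F) : CompletedAlgClosure F) =
      gen hp n • (s : CompletedAlgClosure F) := by
    rw [← CompletedAlgClosure.base_smul_coe, coe_pre]
  rw [Rfun_eq hp hn hy hl (smul_mem_K hp _ hmem), ← gen_smul_traceToLevel_eq,
    gen_smul_traceToLevel hp hn hl hmem, Rfun]

/-- **`K₀`-linearity**: `R_n (ι c * s) = ι c * R_n s`. [folklore] -/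
theorem Rfun_ι_mul (hn : 1 ≤ n) (c : PadicBase F p hp) (s : S hp) (h : ι hp c * (s : CompletedAlgClosure F) ∈ S hp) :
    Rfun hp n ⟨ι hp c * (s : CompletedAlgClosure F), h⟩ = ι hp c * Rfun hp n s := by
  obtain ⟨hl, hmem⟩ := lvl_spec hp n s
  have hy : ((c • pre hp s : NormedAlgClosure F) : CompletedAlgClosure F) = ι hp c * (s : CompletedAlgClosure F) := by
    rw [coe_base_smul, coe_pre]
  rw [Rfun_eq hp hn hy hl (IntermediateField.smul_mem _ hmem), traceToLevel_smul, coe_base_smul, Rfun]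

/-- **Tate's estimate on `S`**: `‖s - R_n s‖ ≤ ‖p‖⁻² ‖γ s - s‖`. [cite: Tate1967, §3.2 Prop. 7] -/
theorem norm_sub_Rfun_le (hn : 2 ≤ n) (s : S hp) :
    ‖(s : CompletedAlgClosure F) - Rfun hp n s‖ ≤
      ‖(p : PadicBase F p hp)‖⁻¹ ^ 2 * ‖gen hp n • (s : CompletedAlgClosure F) - s‖ := by
  obtain ⟨hl, hmem⟩ := lvl_spec hp n s
  conv_lhs => rw [← coe_pre hp s]
  rw [Rfun, ← Completion.coe_sub, Completion.norm_coe]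
  refine (norm_sub_traceToLevel_le hp hn hl hmem).trans (le_of_eq ?_)
  rw [← coe_pre hp s, CompletedAlgClosure.base_smul_coe, ← Completion.coe_sub, Completion.norm_coe]

end Rfun

/-! ### Extension of `R_n` to `X = \\widehat{K_∞}` -/

section Rhat

variable (n : ℕ)

/-- The inclusion `S → X`. [folklore] -/
def incl : S hp → X hp := Set.inclusion (S_subset_X hp)

/-- `S → X` is uniformly inducing. [folklore] -/
theorem isUniformInducing_incl : IsUniformInducing (incl hp) :=
  (isUniformEmbedding_set_inclusion (S_subset_X hp)).isUniformInducing

/-- `S` is dense in `X`. [folklore] -/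
theorem denseRange_incl : DenseRange (incl hp) :=
  (denseRange_inclusion_iff (S_subset_X hp)).mpr subset_rfl

/-- **`R_n` on `X`**: the extension of the uniformly continuous `R_n : S → ℂ_F` to the closure
`X` of `S` (Mathlib `IsDenseInducing.extend`; `ℂ_F` is complete). [cite: Tate1967, §3.1]
[cite: FontaineOuyang2022, §3.1] -/
def Rhat (x : X hp) : CompletedAlgClosure F :=
  ((isUniformInducing_incl hp).isDenseInducing (denseRange_incl hp)).extend (Rfun hp n) x

variable {n}

/-- `Rhat` extends `Rfun`. [folklore] -/
theorem Rhat_incl (hn : 2 ≤ n) (s : S hp) : Rhat hp n (incl hp s) = Rfun hp n s :=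
  uniformly_extend_of_ind (isUniformInducing_incl hp) (denseRange_incl hp)
    (uniformContinuous_Rfun hp hn) s

/-- `Rhat` is continuous. [folklore] -/
theorem continuous_Rhat (hn : 2 ≤ n) : Continuous (Rhat hp n) :=
  (uniformContinuous_uniformly_extend (isUniformInducing_incl hp) (denseRange_incl hp)
    (uniformContinuous_Rfun hp hn)).continuous

/-- **`R_n x` is fixed by `γ`** on `X` (by density). [cite: Tate1967, §3.1] -/
theorem gen_smul_Rhat (hn : 2 ≤ n) (x : X hp) : gen hp n • Rhat hp n x = Rhat hp n x := by
  refine isClosed_property (denseRange_incl hp) (p := fun x => gen hp n • Rhat hp n x = Rhat hp n x)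
    (isClosed_eq ((CompletedAlgClosure.continuous_base_smul hp _).comp (continuous_Rhat hp hn))
      (continuous_Rhat hp hn)) (fun s => ?_) x
  rw [Rhat_incl hp hn, gen_smul_Rfun hp (by omega)]

/-- The action of `γ` on `X`. [folklore] -/
def genX (n : ℕ) (x : X hp) : X hp := ⟨gen hp n • (x : CompletedAlgClosure F), smul_mem_X hp _ x.2⟩

/-- `γ` acts continuously on `X`. [folklore] -/
theorem continuous_genX (n : ℕ) : Continuous (genX hp n) :=
  ((CompletedAlgClosure.continuous_base_smul hp _).comp continuous_subtype_val).subtype_mk _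

/-- **`R_n (γ x) = R_n x`** on `X` (by density). [cite: Tate1967, §3.1] -/
theorem Rhat_genX (hn : 2 ≤ n) (x : X hp) : Rhat hp n (genX hp n x) = Rhat hp n x := by
  refine isClosed_property (denseRange_incl hp) (p := fun x => Rhat hp n (genX hp n x) = Rhat hp n x)
    (isClosed_eq ((continuous_Rhat hp hn).comp (continuous_genX hp n)) (continuous_Rhat hp hn))
    (fun s => ?_) x
  have hmem : gen hp n • (s : CompletedAlgClosure F) ∈ S hp := smul_mem_S hp _ s.2
  have h1 : genX hp n (incl hp s) = incl hp ⟨gen hp n • (s : CompletedAlgClosure F), hmem⟩ := rfl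
  rw [h1, Rhat_incl hp hn, Rhat_incl hp hn, Rfun_gen_smul hp (by omega)]

/-- Multiplication by `ι c` on `X`. [folklore] -/
def mulX (c : PadicBase F p hp) (x : X hp) : X hp := ⟨ι hp c * (x : CompletedAlgClosure F), ι_mul_mem_X hp c x.2⟩

/-- Multiplication by `ι c` is continuous on `X`. [folklore] -/
theorem continuous_mulX (c : PadicBase F p hp) : Continuous (mulX hp c) :=
  ((continuous_const_mul _).comp continuous_subtype_val).subtype_mk _

/-- **`K₀`-linearity on `X`**: `R_n (ι c * x) = ι c * R_n x` (by density). [folklore] -/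
theorem Rhat_mulX (hn : 2 ≤ n) (c : PadicBase F p hp) (x : X hp) :
    Rhat hp n (mulX hp c x) = ι hp c * Rhat hp n x := by
  refine isClosed_property (denseRange_incl hp) (p := fun x => Rhat hp n (mulX hp c x) = ι hp c * Rhat hp n x)
    (isClosed_eq ((continuous_Rhat hp hn).comp (continuous_mulX hp c))
      ((continuous_const_mul _).comp (continuous_Rhat hp hn))) (fun s => ?_) x
  have hmem : ι hp c * (s : CompletedAlgClosure F) ∈ S hp := ι_mul_mem_S hp c s.2
  have h1 : mulX hp c (incl hp s) = incl hp ⟨ι hp c * (s : CompletedAlgClosure F), hmem⟩ := rfl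
  rw [h1, Rhat_incl hp hn, Rhat_incl hp hn, Rfun_ι_mul hp (by omega)]

/-- **Tate's estimate on `X`**: `‖x - R_n x‖ ≤ ‖p‖⁻² ‖γ x - x‖` (by density). [cite: Tate1967, §3.2 Prop. 7] -/
theorem norm_sub_Rhat_le (hn : 2 ≤ n) (x : X hp) :
    ‖(x : CompletedAlgClosure F) - Rhat hp n x‖ ≤
      ‖(p : PadicBase F p hp)‖⁻¹ ^ 2 * ‖gen hp n • (x : CompletedAlgClosure F) - x‖ := by
  refine isClosed_property (denseRange_incl hp)
    (p := fun x : X hp => ‖(x : CompletedAlgClosure F) - Rhat hp n x‖ ≤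
      ‖(p : PadicBase F p hp)‖⁻¹ ^ 2 * ‖gen hp n • (x : CompletedAlgClosure F) - x‖)
    (isClosed_le ((continuous_subtype_val.sub (continuous_Rhat hp hn)).norm)
      (continuous_const.mul (((CompletedAlgClosure.continuous_base_smul hp _).comp
        continuous_subtype_val).sub continuous_subtype_val).norm)) (fun s => ?_) x
  rw [Rhat_incl hp hn]
  exact norm_sub_Rfun_le hp hn s

/-! ### The eigenvector lemma -/

/-- **Tate's eigenvector lemma.** Let `n ≥ 2`, `x ∈ X = \\widehat{K_∞}` and suppose `γ • x = c x`
for a scalar `c ∈ K₀` with `c ≠ 1` and `‖p‖⁻² ‖c - 1‖ < 1`. Then `x = 0`: indeed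
`R_n x = R_n(γ x) = c R_n x` gives `R_n x = 0`, and then `‖x‖ = ‖x - R_n x‖ ≤ ‖p‖⁻² ‖(c - 1) x‖ < ‖x‖`.
[cite: Tate1967, §3.3 (proof of Theorem 2)] [cite: FontaineOuyang2022, §3.2] -/
theorem eq_zero_of_gen_smul_eq (hn : 2 ≤ n) {x : CompletedAlgClosure F} (hxX : x ∈ X hp)
    {c : PadicBase F p hp} (hc1 : c ≠ 1)
    (hsmall : ‖(p : PadicBase F p hp)‖⁻¹ ^ 2 * ‖c - 1‖ < 1) (hx : gen hp n • x = ι hp c * x) :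
    x = 0 := by
  set x' : X hp := ⟨x, hxX⟩ with hx'
  -- `R_n x = 0`
  have hgen : genX hp n x' = mulX hp c x' := Subtype.ext hx
  have hR : Rhat hp n x' = ι hp c * Rhat hp n x' := by
    rw [← Rhat_mulX hp hn, ← hgen, Rhat_genX hp hn]
  have hR0 : Rhat hp n x' = 0 := by
    have h1 : (ι hp c - 1) * Rhat hp n x' = 0 := by rw [sub_mul, one_mul, ← hR, sub_self]
    rcases mul_eq_zero.mp h1 with h | h
    · exfalso
      apply hc1
      have h2 : ι hp c = ι hp 1 := by rw [ι_def hp 1, map_one, map_one]; exact sub_eq_zero.mp h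
      exact (ιHom hp).injective h2
    · exact h
  -- the estimate
  have hest := norm_sub_Rhat_le hp hn x'
  rw [hR0, sub_zero] at hest
  change ‖x‖ ≤ ‖(p : PadicBase F p hp)‖⁻¹ ^ 2 * ‖gen hp n • x - x‖ at hest
  rw [hx, show ι hp c * x - x = (ι hp c - 1) * x by ring, norm_mul, ← map_one (ιHom hp),
    ← ιHom_apply, ← map_sub, ιHom_apply, norm_ι, ← mul_assoc] at hest
  by_contra hne
  have hpos : 0 < ‖x‖ := norm_pos_iff.mpr hne
  have : ‖x‖ < ‖x‖ := by
    calc ‖x‖ ≤ ‖(p : PadicBase F p hp)‖⁻¹ ^ 2 * ‖c - 1‖ * ‖x‖ := hest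
      _ < 1 * ‖x‖ := mul_lt_mul_of_pos_right hsmall hpos
      _ = ‖x‖ := one_mul _
  exact lt_irrefl _ this

end Rhat

/-! ### The cyclotomic character of `γ` and of elements fixing `K_∞` -/

/-- If `g • ζ_{p^M} = ζ_{p^M}` then `χ(g) ≡ 1 (mod p^M)`. [folklore] -/
theorem toZModPow_chi_eq_one {g : BaseGaloisGroup hp} {M : ℕ} (h : g • zeta F p M = zeta F p M) :
    PadicInt.toZModPow M (BaseGaloisGroup.baseCyclotomicCharacter hp g : ℤ_[p]) = 1 := by
  rcases Nat.eq_zero_or_pos M with rfl | hM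
  · haveI : Subsingleton (ZMod (p ^ 0)) := by rw [pow_zero]; infer_instance
    exact Subsingleton.elim _ _
  have hζ := zeta_spec F p M
  have hspec := BaseGaloisGroup.baseCyclotomicCharacter_spec hp g (zeta F p M) hζ.pow_eq_one
  rw [h] at hspec
  -- `ζ^1 = ζ^val`
  have h1 : zeta F p M ^ 1 =
      zeta F p M ^ (PadicInt.toZModPow M (BaseGaloisGroup.baseCyclotomicCharacter hp g : ℤ_[p])).val := by
    rw [pow_one]; exact hspec
  have hfin : IsOfFinOrder (zeta F p M) :=
    isOfFinOrder_iff_pow_eq_one.mpr ⟨p ^ M, pow_pos' M, hζ.pow_eq_one⟩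
  have hmod := (hfin.pow_eq_pow_iff_modEq).mp h1
  rw [← hζ.eq_orderOf] at hmod
  have hpM : 1 < p ^ M := Nat.one_lt_pow hM.ne' (Fact.out : p.Prime).one_lt
  have hval : (PadicInt.toZModPow M (BaseGaloisGroup.baseCyclotomicCharacter hp g : ℤ_[p])).val = 1 := by
    have h2 := hmod.symm
    rw [Nat.ModEq, Nat.mod_eq_of_lt (ZMod.val_lt _), Nat.mod_eq_of_lt hpM] at h2
    exact h2
  exact (ZMod.val_eq_one hpM _).mp hval

/-- **An element of `G₀` fixing every `ζ_{p^M}` has trivial cyclotomic character.** [folklore] -/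
theorem chi_eq_one_of_forall_smul_zeta {g : BaseGaloisGroup hp} (h : ∀ M, g • zeta F p M = zeta F p M) :
    BaseGaloisGroup.baseCyclotomicCharacter hp g = 1 := by
  refine Units.ext (PadicInt.ext_of_toZModPow.mp fun M => ?_)
  rw [toZModPow_chi_eq_one hp (h M), Units.val_one, map_one]

/-- `γ = gen n` fixes `ζ_{p^n}` (`n ≥ 1`). [folklore] -/
theorem gen_smul_zeta_self {n : ℕ} (hn : 1 ≤ n) : gen hp n • zeta F p n = zeta F p n := by
  obtain ⟨i, hi⟩ := exists_zeta_eq_pow (F := F) (p := p) (Nat.le_succ n)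
  rw [hi, smul_pow', gen_smul_zeta hp hn, ← pow_mul, mul_comm, pow_mul, ← hi, pow_add, pow_one,
    (zeta_spec F p n).pow_eq_one, mul_one]

/-- **`χ(γ) ≡ 1 (mod p^n)`**: `‖χ(gen n) - 1‖_{K₀} ≤ ‖p‖^n`. [cite: Tate1967, §3.3] -/
theorem norm_chi_gen_sub_one_le {n : ℕ} (hn : 1 ≤ n) :
    ‖PadicBase.ofPadicInt hp (BaseGaloisGroup.baseCyclotomicCharacter hp (gen hp n) : ℤ_[p]) - 1‖ ≤
      ‖(p : PadicBase F p hp)‖ ^ n := by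
  apply PadicBase.norm_ofPadicInt_sub_one_le
  rw [PadicInt.norm_le_pow_iff_mem_span_pow, ← PadicInt.ker_toZModPow, RingHom.mem_ker, map_sub, map_one,
    toZModPow_chi_eq_one hp (gen_smul_zeta_self hp hn), sub_self]

/-- For a unit-norm `w ∈ K₀` with `‖w - 1‖ ≤ r`: `‖w^m - 1‖ ≤ r` for `m ∈ ℕ`. [folklore] -/
theorem norm_pow_sub_one_le_base {w : PadicBase F p hp} (hw : ‖w‖ = 1) {r : ℝ} (h : ‖w - 1‖ ≤ r) (m : ℕ) :
    ‖w ^ m - 1‖ ≤ r := by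
  have hgs : w ^ m - 1 = (∑ i ∈ range m, w ^ i) * (w - 1) := (geom_sum_mul w m).symm
  rw [hgs, norm_mul]
  refine (mul_le_of_le_one_left (norm_nonneg _) ?_).trans h
  refine IsUltrametricDist.norm_sum_le_of_forall_le_of_nonneg zero_le_one fun i _ => ?_
  rw [norm_pow, hw, one_pow]

/-- … and `‖w^j - 1‖ ≤ r` for `j ∈ ℤ`. [folklore] -/
theorem norm_zpow_sub_one_le_base {w : PadicBase F p hp} (hw : ‖w‖ = 1) {r : ℝ} (h : ‖w - 1‖ ≤ r)
    (j : ℤ) : ‖w ^ j - 1‖ ≤ r := by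
  have hw0 : w ≠ 0 := norm_pos_iff.mp (by rw [hw]; exact one_pos)
  obtain ⟨m, rfl | rfl⟩ := Int.eq_nat_or_neg j
  · rw [zpow_natCast]; exact norm_pow_sub_one_le_base hp hw h m
  · have h1 : w ^ (-(m : ℤ)) - 1 = w ^ (-(m : ℤ)) * (1 - w ^ m) := by
      rw [mul_sub, mul_one, zpow_neg, zpow_natCast, inv_mul_cancel₀ (pow_ne_zero m hw0)]
    rw [h1, norm_mul, norm_zpow, hw, one_zpow, one_mul, norm_sub_rev]
    exact norm_pow_sub_one_le_base hp hw h m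

/-- **`χ(γ)` has infinite order**: `(χ(gen n))^j ≠ 1` in `K₀` for `j ≠ 0` (`n ≥ 2`): otherwise
`γ^{|j|}` would fix every `ζ_{p^M}`, while its exponent `(1 + p^n a)^{|j|}`, `p ∤ a`, is
`≢ 1 (mod p^M)` as soon as `p^{M-n} ∤ |j|` (`PrincipalUnitPowers.prime_pow_dvd_of_pow_modEq_one`).
[cite: Tate1967, §3.3] -/
theorem zpow_chi_gen_ne_one {n : ℕ} (hn : 2 ≤ n) {j : ℤ} (hj : j ≠ 0) :
    (PadicBase.ofPadicInt hp (BaseGaloisGroup.baseCyclotomicCharacter hp (gen hp n) : ℤ_[p])) ^ j ≠ 1 := by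
  have hpP : p.Prime := Fact.out
  set u : ℤ_[p]ˣ := BaseGaloisGroup.baseCyclotomicCharacter hp (gen hp n) with hu
  set w : PadicBase F p hp := PadicBase.ofPadicInt hp (u : ℤ_[p]) with hwdef
  have hw0 : w ≠ 0 := norm_pos_iff.mp (by rw [hwdef, PadicBase.norm_ofPadicInt_units]; exact one_pos)
  intro hwj
  -- `w^m = 1` with `m = |j| > 0`
  set m : ℕ := j.natAbs with hm
  have hm0 : m ≠ 0 := Int.natAbs_ne_zero.mpr hj
  have hwm : w ^ m = 1 := by
    rcases Int.natAbs_eq j with h | h <;> rw [← hm] at h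
    · rw [h, zpow_natCast] at hwj; exact hwj
    · rw [h, zpow_neg, zpow_natCast, inv_eq_one] at hwj; exact hwj
  -- hence `χ(γ^m) = 1`
  have hum : (u : ℤ_[p]) ^ m = 1 := by
    apply PadicBase.ofPadicInt_injective hp
    rw [map_pow, ← hwdef, hwm, map_one]
  have hχm : BaseGaloisGroup.baseCyclotomicCharacter hp (gen hp n ^ m) = 1 := by
    rw [map_pow, ← hu]
    exact Units.ext (by rw [Units.val_pow_eq_pow_val, hum, Units.val_one])
  -- `γ^m` fixes every `ζ_M`, `M ≥ 1`
  have hfix : ∀ M, 1 ≤ M → (gen hp n ^ m) • zeta F p M = zeta F p M := by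
    intro M hM
    have hspec := BaseGaloisGroup.baseCyclotomicCharacter_spec hp (gen hp n ^ m) (zeta F p M)
      (zeta_spec F p M).pow_eq_one
    rw [hχm, Units.val_one, map_one, ZMod.val_one'', pow_one] at hspec
    · exact hspec
    · exact (Nat.one_lt_pow (by omega) hpP.one_lt).ne'
  -- but the exponent of `γ` on `ζ_M`, `M = n + m`, is `1 + p^n a`, `p ∤ a`
  set M : ℕ := n + m with hMdef
  obtain ⟨a, ha, hγ⟩ := exists_gen_smul_zeta hp (show 1 ≤ n by omega) (show n + 1 ≤ M by omega)
  have h1 : zeta F p M ^ (1 + p ^ n * a) ^ m = zeta F p M ^ 1 := by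
    rw [← pow_smul_eq_pow_pow hp hγ m, hfix M (by omega), pow_one]
  have hfin : IsOfFinOrder (zeta F p M) :=
    isOfFinOrder_iff_pow_eq_one.mpr ⟨p ^ M, pow_pos' M, (zeta_spec F p M).pow_eq_one⟩
  have hmod := (hfin.pow_eq_pow_iff_modEq).mp h1
  rw [← (zeta_spec F p M).eq_orderOf] at hmod
  have hdvd := PrincipalUnitPowers.prime_pow_dvd_of_pow_modEq_one hpP hn (by omega) ha hm0 hmod
  rw [show M - n = m by omega] at hdvd
  have hle : p ^ m ≤ m := Nat.le_of_dvd (Nat.pos_of_ne_zero hm0) hdvd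
  have hlt : m < p ^ m := lt_of_lt_of_le m.lt_two_pow_self (Nat.pow_le_pow_left hpP.two_le m)
  exact absurd hle (not_le.mpr hlt)

/-! ### Tate's theorem over the base field -/

/-- `ι` of a power. [folklore] -/
theorem ι_zpow (c : PadicBase F p hp) (j : ℤ) : ι hp (c ^ j) = ι hp c ^ j := by
  rw [← ιHom_apply, map_zpow₀, ιHom_apply]

/-- **Tate's theorem over `ℚ_p` (inside `ℂ_F`)**: for `j ∈ ℤ ∖ {0}`, an element `x ∈ ℂ_F` with
`g • x = ι(χ(g))^j x` for all `g ∈ G₀ = Gal(F̄/ℚ_p)` is `0`; i.e. `ℂ_F(χ^{-j})^{G₀} = 0`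
(Tate 1967, §3.3, Theorem 2 for `H⁰`, the character `χ^{-j}` having infinite order).
[cite: Tate1967, §3.3 Theorem 2] [cite: FontaineOuyang2022, §3.2] -/
theorem eq_zero_of_forall_base_smul_eq {j : ℤ} (hj : j ≠ 0) {x : CompletedAlgClosure F}
    (hx : ∀ g : BaseGaloisGroup hp, g • x =
      ι hp (PadicBase.ofPadicInt hp (BaseGaloisGroup.baseCyclotomicCharacter hp g : ℤ_[p])) ^ j * x) :
    x = 0 := by
  -- (1) `x ∈ X`
  have hxX : x ∈ X hp := by
    rw [← fixedPoints_eq_X hp]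
    intro g hg
    rw [hx g, chi_eq_one_of_forall_smul_zeta hp hg, Units.val_one, map_one, ← ιHom_apply, map_one,
      one_zpow, one_mul]
  -- (2) the eigenvalue of `γ = gen 3`
  set w : PadicBase F p hp :=
    PadicBase.ofPadicInt hp (BaseGaloisGroup.baseCyclotomicCharacter hp (gen hp 3) : ℤ_[p]) with hw
  have hw1 : ‖w‖ = 1 := PadicBase.norm_ofPadicInt_units hp _
  have hwsub : ‖w - 1‖ ≤ ‖(p : PadicBase F p hp)‖ ^ 3 := norm_chi_gen_sub_one_le hp (by norm_num)
  have hc : ‖w ^ j - 1‖ ≤ ‖(p : PadicBase F p hp)‖ ^ 3 := norm_zpow_sub_one_le_base hp hw1 hwsub j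
  have hc1 : w ^ j ≠ 1 := zpow_chi_gen_ne_one hp (by norm_num) hj
  have hp0 := PadicBase.norm_p_pos hp
  have hsmall : ‖(p : PadicBase F p hp)‖⁻¹ ^ 2 * ‖w ^ j - 1‖ < 1 := by
    calc ‖(p : PadicBase F p hp)‖⁻¹ ^ 2 * ‖w ^ j - 1‖
        ≤ ‖(p : PadicBase F p hp)‖⁻¹ ^ 2 * ‖(p : PadicBase F p hp)‖ ^ 3 :=
          mul_le_mul_of_nonneg_left hc (pow_nonneg (inv_nonneg.mpr hp0.le) 2)
      _ = ‖(p : PadicBase F p hp)‖ := by field_simp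
      _ < 1 := PadicBase.norm_p_lt_one hp
  have hγ : gen hp 3 • x = ι hp (w ^ j) * x := by rw [ι_zpow, hw]; exact hx (gen hp 3)
  exact eq_zero_of_gen_smul_eq hp (by norm_num) hxX hc1 hsmall hγ

end TateTrace

end Literature.NumberTheory.PAdicHodge

end
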